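import Literature.RepresentationTheory.ModularTensorCategories.SU2PentagonKL
import Literature.RepresentationTheory.ModularTensorCategories.Gauge

/-!
# The unitary `SU(2)_k` F-symbols are a gauge transform of the Kauffman–Lins q-6j symbols;
# pentagon for `fSym` from the Biedenharn–Elliott identity

Topic `Literature/RepresentationTheory/ModularTensorCategories` (definition item `defn-ModularDatum`; step 2
of the transport prescribed by the review of the `SU(2)_k` bundle).

* `thetaNet_eq_sign_mul`, `abs_thetaNet`, `thetaPos` — for an admissible triad,
  `θ(x,y,z) = (-1)^{(x+y+z)/2} Θ` with `Θ = [s+1]![m]![n]![p]!/([y]![z]![x]!) > 0`;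
  `triangleSq_mul_theta` — `Δ(x,y,z)² Θ = ([m]![n]![p]!)²/([y]![z]![x]!)`; `abs_klDelta`.
* `fSym_core` — the scalar identity behind the gauge relation (all four triads admissible):
  `(-1)^{(a+b+c+d)/2} √([e+1][f+1]) sixJ(a,b,e,c,d,f) = Tet[a b f; c d e] Δ_f/(θ(a,d,f)θ(b,c,f)) · γ`,
  `γ = √(|Δ_e θ(b,c,f) θ(a,f,d)| / |Δ_f θ(a,b,e) θ(e,c,d)|)`: the twelve `bⱼ - aᵢ` of `Tet` are the
  triad numbers, `Π_T Δ_T² = (𝓘!/𝓔!)²/Π_T Θ_T`, and the signs satisfy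
  `(a+f+d)/2 + (b+c+f)/2 = (a+b+c+d)/2 + f`.
* `fSym_pentagon` — **the pentagon identity for `fSym k`** (index form of `PreModularDatum.pentagon`)
  from `KLPentagon k`, via `sixjKL_pentagon_F` and `pentagon_of_gauge` with `u = |θ|^{-1/2}`,
  `v = |Δ|^{-1/2}`.
[cite: KauffmanLins1994, §7.3 Prop. 10 and §9.9–9.14] [cite: Kitaev2006, App. E.6 (gauge freedom)]
-/

noncomputable section

namespace Literature.RepresentationTheory.ModularTensorCategories.SU2LevelK

open Finset

variable (k : ℕ)

/-! ### Step 2 of the transport: elementary evaluations of θ-nets and triangle coefficients -/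

/-- Admissibility is symmetric in the last two labels. [folklore] -/
theorem adm_swap {a b c : ℕ} : Adm k a b c ↔ Adm k a c b := by
  unfold Adm; omega

/-- Admissibility is invariant under cyclic rotation of the labels. [folklore] -/
theorem adm_rot {a b c : ℕ} : Adm k a b c ↔ Adm k c a b := by
  unfold Adm; omega

/-- `θ(a,b,c) = θ(a,c,b)`. [cite: KauffmanLins1994, §9.10 (i)] -/
theorem thetaNet_swap (a b c : ℕ) : thetaNet k a b c = thetaNet k a c b := by
  unfold thetaNet
  simp only
  rw [Nat.add_comm c b]
  generalize (a + b - c) / 2 = m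
  generalize (b + c - a) / 2 = n
  generalize (a + c - b) / 2 = p
  rw [show p + n + m = m + n + p by omega, Nat.add_comm n m, Nat.add_comm m p, Nat.add_comm p n]
  ring

/-- `[n]! > 0` for `n ≤ k + 1`. [folklore] -/
theorem qFactorial_pos {n : ℕ} (hn : n ≤ k + 1) : 0 < qFactorial k n := by
  unfold qFactorial
  refine Finset.prod_pos (fun m hm => ?_)
  rw [Finset.mem_range] at hm
  exact qInt_pos k (by omega) (by omega)

/-- The positive part of the θ-net: for an admissible triad with `m = (x+y-z)/2, n = (y+z-x)/2,
p = (x+z-y)/2`, `θ(x,y,z) = (-1)^{(x+y+z)/2} Θ` with `Θ = [s+1]![m]![n]![p]!/([y]![z]![x]!)`,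
`s = (x+y+z)/2`. [cite: KauffmanLins1994, §9.10 (i)] -/
theorem thetaNet_eq_sign_mul {x y z : ℕ} (h : Adm k x y z) :
    thetaNet k x y z = (-1 : ℝ) ^ ((x + y + z) / 2) *
      (qFactorial k ((x + y + z) / 2 + 1) * qFactorial k ((x + y - z) / 2) * qFactorial k ((y + z - x) / 2) *
        qFactorial k ((x + z - y) / 2) / (qFactorial k y * qFactorial k z * qFactorial k x)) := by
  unfold thetaNet Adm at *
  simp only
  rw [show (x + y - z) / 2 + (y + z - x) / 2 + (x + z - y) / 2 = (x + y + z) / 2 by omega,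
    show (x + y - z) / 2 + (y + z - x) / 2 = y by omega, show (y + z - x) / 2 + (x + z - y) / 2 = z by omega,
    show (x + z - y) / 2 + (x + y - z) / 2 = x by omega]
  ring

/-- Positivity of `Θ`. [folklore] -/
theorem thetaPos {x y z : ℕ} (h : Adm k x y z) :
    0 < qFactorial k ((x + y + z) / 2 + 1) * qFactorial k ((x + y - z) / 2) * qFactorial k ((y + z - x) / 2) *
        qFactorial k ((x + z - y) / 2) / (qFactorial k y * qFactorial k z * qFactorial k x) := by
  unfold Adm at h
  apply div_pos
  · refine mul_pos (mul_pos (mul_pos (qFactorial_pos k (by omega)) (qFactorial_pos k (by omega)))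
      (qFactorial_pos k (by omega))) (qFactorial_pos k (by omega))
  · exact mul_pos (mul_pos (qFactorial_pos k (by omega)) (qFactorial_pos k (by omega)))
      (qFactorial_pos k (by omega))

/-- `triangleSq(x,y,z) · Θ(x,y,z) = ([m]![n]![p]!)² / ([y]![z]![x]!)`. [cite: KauffmanLins1994, §9.10 (i)] -/
theorem triangleSq_mul_theta {x y z : ℕ} (h : Adm k x y z) :
    triangleSq k x y z *
      (qFactorial k ((x + y + z) / 2 + 1) * qFactorial k ((x + y - z) / 2) * qFactorial k ((y + z - x) / 2) *
        qFactorial k ((x + z - y) / 2) / (qFactorial k y * qFactorial k z * qFactorial k x)) =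
    (qFactorial k ((x + y - z) / 2) * qFactorial k ((y + z - x) / 2) * qFactorial k ((x + z - y) / 2)) ^ 2 /
      (qFactorial k y * qFactorial k z * qFactorial k x) := by
  unfold triangleSq
  have hs : qFactorial k ((x + y + z) / 2 + 1) ≠ 0 := (qFactorial_pos k (by unfold Adm at h; omega)).ne'
  field_simp

end Literature.RepresentationTheory.ModularTensorCategories.SU2LevelK

namespace Literature.RepresentationTheory.ModularTensorCategories.SU2LevelK

open Finset

variable (k : ℕ)

/-- `|θ| = Θ` for an admissible triad. [folklore] -/
theorem abs_thetaNet {x y z : ℕ} (h : Adm k x y z) :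
    |thetaNet k x y z| =
      qFactorial k ((x + y + z) / 2 + 1) * qFactorial k ((x + y - z) / 2) * qFactorial k ((y + z - x) / 2) *
        qFactorial k ((x + z - y) / 2) / (qFactorial k y * qFactorial k z * qFactorial k x) := by
  rw [thetaNet_eq_sign_mul k h, abs_mul, abs_pow, abs_neg, abs_one, one_pow, one_mul,
    abs_of_pos (thetaPos k h)]

/-- `|Δ_n| = [n+1]` and `Δ_n = (-1)^n [n+1]` for `n ≤ k`. [cite: KauffmanLins1994, §9.4] -/
theorem abs_klDelta {n : ℕ} (hn : n ≤ k) : |klDelta k n| = qInt k (n + 1) := by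
  unfold klDelta
  rw [abs_mul, abs_pow, abs_neg, abs_one, one_pow, one_mul, abs_of_pos (qInt_pos k (by omega) (by omega))]

/-- **The unitary F-symbols of `SU(2)_k` are a gauge transform of the Kauffman–Lins q-6j symbols**
(scalar core, natural-number labels, all four triads admissible):
`(-1)^{(a+b+c+d)/2} √([e+1][f+1]) · sixJ(a,b,e,c,d,f) = {a b f; c d e}_KL^{unguarded} · √(|Δ_e θ(b,c,f) θ(a,f,d)| / |Δ_f θ(a,b,e) θ(e,c,d)|)`.
[cite: KauffmanLins1994, §9.10–9.12 (θ, Tet, q-6j closed formulas)] -/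
theorem fSym_core {a b c d e f : ℕ} (h1 : Adm k a b e) (h2 : Adm k e c d) (h3 : Adm k b c f)
    (h4 : Adm k a f d) :
    (-1 : ℝ) ^ ((a + b + c + d) / 2) * Real.sqrt (qInt k (e + 1) * qInt k (f + 1)) * sixJ k a b e c d f =
      tetNet k a b f c d e * klDelta k f / (thetaNet k a d f * thetaNet k b c f) *
        Real.sqrt (|klDelta k e| * |thetaNet k b c f| * |thetaNet k a f d| /
          (|klDelta k f| * |thetaNet k a b e| * |thetaNet k e c d|)) := by
  have h1' := h1; have h2' := h2; have h3' := h3; have h4' := h4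
  unfold Adm at h1' h2' h3' h4'
  rw [thetaNet_swap k a d f, abs_thetaNet k h1, abs_thetaNet k h2, abs_thetaNet k h3, abs_thetaNet k h4,
    abs_klDelta k (by omega : e ≤ k), abs_klDelta k (by omega : f ≤ k),
    thetaNet_eq_sign_mul k h3, thetaNet_eq_sign_mul k h4, tetNet_eq]
  unfold sixJ klDelta
  have hT1 := triangleSq_mul_theta k h1
  have hT2 := triangleSq_mul_theta k h2
  have hT3 := triangleSq_mul_theta k h3
  have hT4 := triangleSq_mul_theta k h4
  have hP1 := thetaPos k h1
  have hP2 := thetaPos k h2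
  have hP3 := thetaPos k h3
  have hP4 := thetaPos k h4
  -- the twelve differences bⱼ - aᵢ are the triad numbers
  rw [show (b + d + f + e) / 2 - (a + d + f) / 2 = (b + e - a) / 2 by omega,
    show (b + d + f + e) / 2 - (b + c + f) / 2 = (e + d - c) / 2 by omega,
    show (b + d + f + e) / 2 - (a + b + e) / 2 = (f + d - a) / 2 by omega,
    show (b + d + f + e) / 2 - (c + d + e) / 2 = (b + f - c) / 2 by omega,
    show (a + c + f + e) / 2 - (a + d + f) / 2 = (e + c - d) / 2 by omega,
    show (a + c + f + e) / 2 - (b + c + f) / 2 = (a + e - b) / 2 by omega,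
    show (a + c + f + e) / 2 - (a + b + e) / 2 = (c + f - b) / 2 by omega,
    show (a + c + f + e) / 2 - (c + d + e) / 2 = (a + f - d) / 2 by omega,
    show (a + b + c + d) / 2 - (a + d + f) / 2 = (b + c - f) / 2 by omega,
    show (a + b + c + d) / 2 - (b + c + f) / 2 = (a + d - f) / 2 by omega,
    show (a + b + c + d) / 2 - (a + b + e) / 2 = (c + d - e) / 2 by omega,
    show (a + b + c + d) / 2 - (c + d + e) / 2 = (a + b - e) / 2 by omega]
  -- signs
  have hσ : (-1 : ℝ) ^ ((a + b + c + d) / 2) = (-1 : ℝ) ^ f * (-1) ^ ((a + f + d) / 2) * (-1) ^ ((b + c + f) / 2) := by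
    rw [← pow_add, ← pow_add, show f + (a + f + d) / 2 + (b + c + f) / 2 = (a + b + c + d) / 2 + 2 * f by omega,
      pow_add, pow_mul, neg_one_sq, one_pow, mul_one]
  have hs3 : ((-1 : ℝ) ^ ((b + c + f) / 2)) * (-1 : ℝ) ^ ((b + c + f) / 2) = 1 := by
    rw [← pow_add, ← two_mul, pow_mul, neg_one_sq, one_pow]
  have hs4 : ((-1 : ℝ) ^ ((a + f + d) / 2)) * (-1 : ℝ) ^ ((a + f + d) / 2) = 1 := by
    rw [← pow_add, ← two_mul, pow_mul, neg_one_sq, one_pow]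
  rw [hσ]
  generalize (-1 : ℝ) ^ ((a + f + d) / 2) = σ₄ at hs4 ⊢
  generalize (-1 : ℝ) ^ ((b + c + f) / 2) = σ₃ at hs3 ⊢
  generalize (-1 : ℝ) ^ f = τ
  -- positivity of the elementary atoms
  have hqe : 0 < qInt k (e + 1) := qInt_pos k (by omega) (by omega)
  have hqf : 0 < qInt k (f + 1) := qInt_pos k (by omega) (by omega)
  have hA : 0 < qFactorial k a := qFactorial_pos k (by omega)
  have hB : 0 < qFactorial k b := qFactorial_pos k (by omega)
  have hC : 0 < qFactorial k c := qFactorial_pos k (by omega)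
  have hD : 0 < qFactorial k d := qFactorial_pos k (by omega)
  have hE : 0 < qFactorial k e := qFactorial_pos k (by omega)
  have hF : 0 < qFactorial k f := qFactorial_pos k (by omega)
  have hm1 : 0 < qFactorial k ((a + b - e) / 2) := qFactorial_pos k (by omega)
  have hn1 : 0 < qFactorial k ((b + e - a) / 2) := qFactorial_pos k (by omega)
  have hp1 : 0 < qFactorial k ((a + e - b) / 2) := qFactorial_pos k (by omega)
  have hm2 : 0 < qFactorial k ((e + c - d) / 2) := qFactorial_pos k (by omega)
  have hn2 : 0 < qFactorial k ((c + d - e) / 2) := qFactorial_pos k (by omega)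
  have hp2 : 0 < qFactorial k ((e + d - c) / 2) := qFactorial_pos k (by omega)
  have hm3 : 0 < qFactorial k ((b + c - f) / 2) := qFactorial_pos k (by omega)
  have hn3 : 0 < qFactorial k ((c + f - b) / 2) := qFactorial_pos k (by omega)
  have hp3 : 0 < qFactorial k ((b + f - c) / 2) := qFactorial_pos k (by omega)
  have hm4 : 0 < qFactorial k ((a + f - d) / 2) := qFactorial_pos k (by omega)
  have hn4 : 0 < qFactorial k ((f + d - a) / 2) := qFactorial_pos k (by omega)
  have hp4 : 0 < qFactorial k ((a + d - f) / 2) := qFactorial_pos k (by omega)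
  -- generalize the θ-magnitudes and all atoms
  generalize qFactorial k ((a + b + e) / 2 + 1) * qFactorial k ((a + b - e) / 2) * qFactorial k ((b + e - a) / 2) *
        qFactorial k ((a + e - b) / 2) / (qFactorial k b * qFactorial k e * qFactorial k a) = Θ₁ at hT1 hP1 ⊢
  generalize qFactorial k ((e + c + d) / 2 + 1) * qFactorial k ((e + c - d) / 2) * qFactorial k ((c + d - e) / 2) *
        qFactorial k ((e + d - c) / 2) / (qFactorial k c * qFactorial k d * qFactorial k e) = Θ₂ at hT2 hP2 ⊢
  generalize qFactorial k ((b + c + f) / 2 + 1) * qFactorial k ((b + c - f) / 2) * qFactorial k ((c + f - b) / 2) *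
        qFactorial k ((b + f - c) / 2) / (qFactorial k c * qFactorial k f * qFactorial k b) = Θ₃ at hT3 hP3 ⊢
  generalize qFactorial k ((a + f + d) / 2 + 1) * qFactorial k ((a + f - d) / 2) * qFactorial k ((f + d - a) / 2) *
        qFactorial k ((a + d - f) / 2) / (qFactorial k f * qFactorial k d * qFactorial k a) = Θ₄ at hT4 hP4 ⊢
  generalize triangleSq k a b e = T₁ at hT1 ⊢
  generalize triangleSq k e c d = T₂ at hT2 ⊢
  generalize triangleSq k b c f = T₃ at hT3 ⊢
  generalize triangleSq k a f d = T₄ at hT4 ⊢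
  generalize qInt k (e + 1) = qe at hqe ⊢
  generalize qInt k (f + 1) = qf at hqf ⊢
  generalize qFactorial k a = A at hA hT1 hT4 ⊢
  generalize qFactorial k b = B at hB hT1 hT3 ⊢
  generalize qFactorial k c = C at hC hT2 hT3 ⊢
  generalize qFactorial k d = D at hD hT2 hT4 ⊢
  generalize qFactorial k e = E at hE hT1 hT2 ⊢
  generalize qFactorial k f = F at hF hT3 hT4 ⊢
  generalize qFactorial k ((a + b - e) / 2) = m₁ at hm1 hT1 ⊢
  generalize qFactorial k ((b + e - a) / 2) = n₁ at hn1 hT1 ⊢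
  generalize qFactorial k ((a + e - b) / 2) = p₁ at hp1 hT1 ⊢
  generalize qFactorial k ((e + c - d) / 2) = m₂ at hm2 hT2 ⊢
  generalize qFactorial k ((c + d - e) / 2) = n₂ at hn2 hT2 ⊢
  generalize qFactorial k ((e + d - c) / 2) = p₂ at hp2 hT2 ⊢
  generalize qFactorial k ((b + c - f) / 2) = m₃ at hm3 hT3 ⊢
  generalize qFactorial k ((c + f - b) / 2) = n₃ at hn3 hT3 ⊢
  generalize qFactorial k ((b + f - c) / 2) = p₃ at hp3 hT3 ⊢
  generalize qFactorial k ((a + f - d) / 2) = m₄ at hm4 hT4 ⊢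
  generalize qFactorial k ((f + d - a) / 2) = n₄ at hn4 hT4 ⊢
  generalize qFactorial k ((a + d - f) / 2) = p₄ at hp4 hT4 ⊢
  generalize racahSum k a b e c d f = R
  -- Step 1: the triangle coefficients in terms of Θ
  have hT1' : T₁ = (m₁ * n₁ * p₁) ^ 2 / (B * E * A * Θ₁) := by
    rw [← div_div, ← hT1, mul_div_assoc, div_self hP1.ne', mul_one]
  have hT2' : T₂ = (m₂ * n₂ * p₂) ^ 2 / (C * D * E * Θ₂) := by
    rw [← div_div, ← hT2, mul_div_assoc, div_self hP2.ne', mul_one]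
  have hT3' : T₃ = (m₃ * n₃ * p₃) ^ 2 / (C * F * B * Θ₃) := by
    rw [← div_div, ← hT3, mul_div_assoc, div_self hP3.ne', mul_one]
  have hT4' : T₄ = (m₄ * n₄ * p₄) ^ 2 / (F * D * A * Θ₄) := by
    rw [← div_div, ← hT4, mul_div_assoc, div_self hP4.ne', mul_one]
  -- Step 2: √(T₁T₂T₃T₄)
  have hX : T₁ * T₂ * T₃ * T₄ =
      (m₁ * n₁ * p₁ * (m₂ * n₂ * p₂) * (m₃ * n₃ * p₃) * (m₄ * n₄ * p₄)) ^ 2 /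
        ((A * B * C * D * E * F) ^ 2 * (Θ₁ * Θ₂ * Θ₃ * Θ₄)) := by
    rw [hT1', hT2', hT3', hT4']
    field_simp
  have hST : Real.sqrt (T₁ * T₂ * T₃ * T₄) =
      m₁ * n₁ * p₁ * (m₂ * n₂ * p₂) * (m₃ * n₃ * p₃) * (m₄ * n₄ * p₄) /
        (A * B * C * D * E * F * Real.sqrt (Θ₁ * Θ₂ * Θ₃ * Θ₄)) := by
    rw [hX, Real.sqrt_div' _ (by positivity), Real.sqrt_sq (by positivity),
      Real.sqrt_mul (by positivity), Real.sqrt_sq (by positivity)]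
  -- Step 3: the magnitudes
  have hM : Real.sqrt (qe * Θ₃ * Θ₄ / (qf * Θ₁ * Θ₂)) =
      Θ₄ * Θ₃ / qf * (Real.sqrt (qe * qf) / Real.sqrt (Θ₁ * Θ₂ * Θ₃ * Θ₄)) := by
    rw [← Real.sqrt_div' _ (by positivity), ← Real.sqrt_sq (by positivity : (0 : ℝ) ≤ Θ₄ * Θ₃ / qf),
      ← Real.sqrt_mul (sq_nonneg _)]
    congr 1
    field_simp
  -- Step 4: signs σ² = 1 and assembly
  have hσ3 : σ₃⁻¹ = σ₃ := inv_eq_of_mul_eq_one_right hs3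
  have hσ4 : σ₄⁻¹ = σ₄ := inv_eq_of_mul_eq_one_right hs4
  have hσ3ne : σ₃ ≠ 0 := fun h0 => by rw [h0, mul_zero] at hs3; exact zero_ne_one hs3
  have hσ4ne : σ₄ ≠ 0 := fun h0 => by rw [h0, mul_zero] at hs4; exact zero_ne_one hs4
  rw [hST, hM]
  rw [show n₁ * p₂ * n₄ * p₃ * (m₂ * p₁ * n₃ * m₄) * (m₃ * p₄ * n₂ * m₁) / (A * B * C * D * F * E) * R * (τ * qf) /
        (σ₄ * Θ₄ * (σ₃ * Θ₃)) =
      n₁ * p₂ * n₄ * p₃ * (m₂ * p₁ * n₃ * m₄) * (m₃ * p₄ * n₂ * m₁) / (A * B * C * D * F * E) * R * (τ * qf) /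
        (Θ₄ * Θ₃) * (σ₄⁻¹ * σ₃⁻¹) by
    field_simp, hσ3, hσ4]
  field_simp

end Literature.RepresentationTheory.ModularTensorCategories.SU2LevelK

namespace Literature.RepresentationTheory.ModularTensorCategories.SU2LevelK

open Finset
open scoped ComplexConjugate

variable (k : ℕ)

/-- The gauge factor in product form: `√(y_e x₃ x₄/(y_f x₁ x₂)) = (√x₁)⁻¹(√x₂)⁻¹(√y_f)⁻¹ / ((√x₃)⁻¹(√x₄)⁻¹(√y_e)⁻¹)`
for positive reals. [folklore] -/
theorem sqrt_gauge_factor {x₁ x₂ x₃ x₄ ye yf : ℝ} (h1 : 0 < x₁) (h2 : 0 < x₂) (h3 : 0 < x₃) (h4 : 0 < x₄)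
    (he : 0 < ye) (hf : 0 < yf) :
    Real.sqrt (ye * x₃ * x₄ / (yf * x₁ * x₂)) =
      (Real.sqrt x₁)⁻¹ * (Real.sqrt x₂)⁻¹ * (Real.sqrt yf)⁻¹ /
        ((Real.sqrt x₃)⁻¹ * (Real.sqrt x₄)⁻¹ * (Real.sqrt ye)⁻¹) := by
  have s1 := Real.sqrt_pos.mpr h1; have s2 := Real.sqrt_pos.mpr h2; have s3 := Real.sqrt_pos.mpr h3
  have s4 := Real.sqrt_pos.mpr h4; have se := Real.sqrt_pos.mpr he; have sf := Real.sqrt_pos.mpr hf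
  rw [show (Real.sqrt x₁)⁻¹ * (Real.sqrt x₂)⁻¹ * (Real.sqrt yf)⁻¹ /
        ((Real.sqrt x₃)⁻¹ * (Real.sqrt x₄)⁻¹ * (Real.sqrt ye)⁻¹) =
      Real.sqrt ye * Real.sqrt x₃ * Real.sqrt x₄ / (Real.sqrt yf * Real.sqrt x₁ * Real.sqrt x₂) by
    field_simp]
  rw [Real.sqrt_div' _ (by positivity), Real.sqrt_mul (by positivity), Real.sqrt_mul (by positivity),
    Real.sqrt_mul (by positivity), Real.sqrt_mul (by positivity)]

/-- **Pentagon identity for the unitary `SU(2)_k` F-symbols**, from the Kauffman–Lins pentagon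
(Biedenharn–Elliott) identity by the gauge transport: `fSym = {a b f; c d e}_KL · γ` with the gauge
factor `γ = u(a,b,e)u(e,c,d)v(f)/(u(b,c,f)u(a,f,d)v(e))`, `u = |θ|^{-1/2}`, `v = |Δ|^{-1/2}`
(`fSym_core`), `sixjKL_pentagon_F` and `pentagon_of_gauge`.
[cite: KauffmanLins1994, §7.3 Prop. 10 (Biedenharn–Elliott) and §9.9–9.14; Kitaev2006, App. E.6 (gauge freedom)] -/
theorem fSym_pentagon (hKL : KLPentagon k) (a b c d e f g k' l : Fin (k + 1)) :
    fSym k f c d e g l * fSym k a b l e f k' =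
      ∑ h : Fin (k + 1), fSym k a b c g f h * fSym k a h d e g k' * fSym k b c d k' h l := by
  -- the gauge functions
  let u : Fin (k + 1) → Fin (k + 1) → Fin (k + 1) → ℂ := fun x y z =>
    if Adm k x y z then (((Real.sqrt |thetaNet k x y z|)⁻¹ : ℝ) : ℂ) else 1
  let v : Fin (k + 1) → ℂ := fun x => (((Real.sqrt |klDelta k x|)⁻¹ : ℝ) : ℂ)
  have hle : ∀ z : Fin (k + 1), (z : ℕ) ≤ k := fun z => Nat.lt_succ_iff.mp z.isLt
  have habsθ : ∀ {x y z : ℕ}, Adm k x y z → 0 < |thetaNet k x y z| := fun h => by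
    rw [abs_thetaNet k h]; exact thetaPos k h
  have habsΔ : ∀ x : Fin (k + 1), 0 < |klDelta k x| := fun x => by
    rw [abs_klDelta k (hle x)]; exact qInt_pos k (by omega) (by have := hle x; omega)
  have hu : ∀ x y z, u x y z ≠ 0 := by
    intro x y z
    simp only [u]
    split_ifs with h
    · exact_mod_cast (inv_pos.mpr (Real.sqrt_pos.mpr (habsθ h))).ne'
    · exact one_ne_zero
  have hv : ∀ x, v x ≠ 0 := fun x => by
    simp only [v]
    exact_mod_cast (inv_pos.mpr (Real.sqrt_pos.mpr (habsΔ x))).ne'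
  refine pentagon_of_gauge (fun (a b c d e f : Fin (k + 1)) => (sixjKL k a b f c d e : ℂ)) (fSym k) u v hu hv ?_ ?_
    a b c d e f g k' l
  · -- the gauge relation fSym = {a b f; c d e} · γ
    intro a b c d e f
    by_cases hadm : Adm k a b e ∧ Adm k e c d ∧ Adm k b c f ∧ Adm k a f d
    · obtain ⟨h1, h2, h3, h4⟩ := hadm
      have h4' : Adm k a d f := (adm_swap k).mp h4
      have h2' : Adm k c d e := (adm_rot k).mpr h2
      unfold fSym
      rw [if_pos ⟨h1, h2, h3, h4⟩]
      simp only [u, v]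
      rw [if_pos h1, if_pos h2, if_pos h3, if_pos h4]
      unfold sixjKL
      rw [if_pos ⟨h4', h3, h1, h2'⟩]
      have core := fSym_core k h1 h2 h3 h4
      rw [sqrt_gauge_factor (habsθ h1) (habsθ h2) (habsθ h3) (habsθ h4) (habsΔ e) (habsΔ f),
        ← mul_div_assoc] at core
      push_cast
      rw [show Complex.ofReal (Real.sqrt (qInt k (e + 1) * qInt k (f + 1))) =
          (Real.sqrt (qInt k (e + 1) * qInt k (f + 1)) : ℂ) from rfl]
      exact_mod_cast core
    · unfold fSym
      rw [if_neg hadm]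
      have hG : ¬ (Adm k a d f ∧ Adm k b c f ∧ Adm k a b e ∧ Adm k c d e) := by
        rintro ⟨h4', h3, h1, h2'⟩
        apply hadm
        exact ⟨h1, (adm_rot k).mp h2', h3, (adm_swap k).mpr h4'⟩
      unfold sixjKL
      rw [if_neg hG]
      simp
  · -- the Kauffman–Lins pentagon in the F-arrangement, cast to ℂ
    intro a b c d e f g k' l
    have h := sixjKL_pentagon_F k hKL a b c d e f g k' l
    exact_mod_cast congrArg Complex.ofReal h

end Literature.RepresentationTheory.ModularTensorCategories.SU2LevelK
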